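import Mathlib.Topology.Algebra.Group.Basic
import Literature.AnabelianGeometry.SemiGraphs.CosetCategories
import Literature.AlgebraicGeometry.Frobenioids.CategoriesFactorization
import HarnessLib

/-!
# The small coset category `CosetCat G` is of FSM-type (every monomorphism is an isomorphism)

Mochizuki, *The geometry of Frobenioids II*, Kyushu J. Math. **62** (2008) 401–460, §1: Example 1.3 (i),
author's text p. 11 [cite: MochizukiFrdII2008, Ex 1.3 (i) p.11]: "`E⁰` is a connected, totally epimorphic
category, which is of FSM-type [indeed, every monomorphism of `E⁰` is an isomorphism], hence, in particular, of
FSMFF-type"; and p. 7 [cite: MochizukiFrdII2008, Ex 1.1 (i) p.7]: "`D₀` [the connected finite étale coverings of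
`Spec(ℚ_p)`] is a connected, totally epimorphic category, which is of FSM-, hence also of FSMFF-type".

PROOF-ONLY (no definitions) companion of abc-iut-L5-t2's `CosetCategories.lean` (the SMALL model `CosetCat G` of `𝓑(G)⁰`:
objects the open subgroups `U ⊆ G` standing for `G/U`, morphisms the `G`-equivariant maps), which proves
`CosetCat G` connected and totally epimorphic but not the third standing hypothesis on a base category of a
`p`-adic Frobenioid ([FrdII] Ex. 1.1 (ii), Thm. 1.2 (i)): FSM-type. For a topological GROUP `G`
(`IsTopologicalGroup`, so that conjugates of open subgroups are open) we prove:

* `CosetCat.toFun_surjective` — every morphism `G/U → G/V` is surjective (the target is one orbit);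
* `CosetCat.toFun_injective_of_mono` — a monomorphism is injective: two cosets `aU`, `a'U` with the same image
  give two morphisms `G/W → G/U`, `W = aUa⁻¹ ∩ a'Ua'⁻¹` (a common open stabiliser, `CosetCat.exists_openSubgroup_smul_coe_eq`), equalised
  by the monomorphism;
* `CosetCat.isIso_of_bijective`, `CosetCat.isIso_of_mono` — hence "every monomorphism is an isomorphism";
* `CosetCat.isOfFSMType`, `CosetCat.isOfFSMFFType` — `CosetCat G` is of FSM-type, hence of FSMFF-type
  ([FrdI] §0; `IsOfFSMType`, `IsOfFSMFFType` of abc-iut-found's `Categories*.lean`).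

Consequence used downstream: over the real Galois bases `CosetCat Gal(Ω/k)` of abc-iut-L5-t2's
`GoodLocalFrobenioidOfGalois.lean` and of [FrdII] Ex. 1.1's `D₀`, the premise `IsOfFSMType D` of abc-iut-L1-d10's
`PadicFrd.Datum.isMonoidData_of_isOfFSMType` / `isFrobenioid_of_isOfFSMType` / `thm12_isOfStandardType_of_isOfFSMType`
is now discharged. Pure topological-group / category theory over Mathlib; nothing of the disputed series is
asserted; no statement of the paper is strengthened.
-/

namespace Literature.AnabelianGeometry.SemiGraphs

namespace CosetCat

open CategoryTheory Literature.AlgebraicGeometry.Frobenioids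

universe u

variable {G : Type u} [Group G] [TopologicalSpace G]

/-! ### Every morphism of `CosetCat G` is surjective -/

/-- A morphism `G/U → G/V` is surjective: `bV` is the image of `b a⁻¹ U` when `1·U ↦ aV`.
[cite: MochizukiFrdII2008, Ex 1.3 (i) p.11] -/
theorem toFun_surjective {X Y : CosetCat G} (f : X ⟶ Y) : Function.Surjective (Hom.toFun f) := by
  intro y
  obtain ⟨b, rfl⟩ := QuotientGroup.mk_surjective y
  obtain ⟨a, ha⟩ := QuotientGroup.mk_surjective (pt f)
  refine ⟨((b * a⁻¹ : G) : X.carrier), ?_⟩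
  rw [toFun_coe, ← ha, MulAction.Quotient.smul_coe, smul_eq_mul, inv_mul_cancel_right]

/-- A point `aV ∈ G/V` is fixed by `u` iff `a⁻¹ u a ∈ V`. [cite: MochizukiFrdII2008, Ex 1.3 (i) p.11] -/
theorem smul_coe_eq_coe_iff (X : CosetCat G) (u a : G) :
    u • ((a : G) : X.carrier) = (a : X.carrier) ↔ a⁻¹ * u * a ∈ X.sg := by
  rw [MulAction.Quotient.smul_coe, smul_eq_mul, QuotientGroup.eq]
  have h : (u * a)⁻¹ * a = (a⁻¹ * u * a)⁻¹ := by simp only [mul_inv_rev, inv_inv, mul_assoc]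
  rw [h, inv_mem_iff]
  exact Iff.rfl

/-! ### Monomorphisms are injective (topological groups) -/

section TopologicalGroup

variable [IsTopologicalGroup G]

/-- The coset `aU ∈ G/U` has an OPEN stabiliser containing the open subgroup `a U a⁻¹` (conjugation is a
homeomorphism of the topological group `G`). [cite: MochizukiFrdII2008, Ex 1.3 (i) p.11] -/
theorem exists_openSubgroup_smul_coe_eq (X : CosetCat G) (a : G) :
    ∃ W : OpenSubgroup G, ∀ u ∈ W, u • ((a : G) : X.carrier) = (a : X.carrier) := by
  refine ⟨X.sg.comap (MulAut.conj a⁻¹).toMonoidHom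
    ((continuous_const.mul continuous_id).mul continuous_const), fun u hu => ?_⟩
  rw [smul_coe_eq_coe_iff]
  have hu' : (MulAut.conj a⁻¹) u ∈ X.sg := hu
  rwa [MulAut.conj_apply, inv_inv] at hu'

/-- **A monomorphism `G/U → G/V` of `CosetCat G` is injective**: if `aU` and `a'U` have the same image, the two
morphisms `G/W → G/U` (`W = aUa⁻¹ ∩ a'Ua'⁻¹`) picking `aU` and `a'U` are equalised by the monomorphism.
[cite: MochizukiFrdII2008, Ex 1.3 (i) p.11] -/
theorem toFun_injective_of_mono {X Y : CosetCat G} (f : X ⟶ Y) [Mono f] : Function.Injective (Hom.toFun f) := by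
  intro x x' h
  obtain ⟨a, rfl⟩ := QuotientGroup.mk_surjective x
  obtain ⟨a', rfl⟩ := QuotientGroup.mk_surjective x'
  obtain ⟨W, hW⟩ := exists_openSubgroup_smul_coe_eq X a
  obtain ⟨W', hW'⟩ := exists_openSubgroup_smul_coe_eq X a'
  let Z : CosetCat G := ⟨W ⊓ W'⟩
  have hZ : ∀ u ∈ Z.sg, u • ((a : G) : X.carrier) = (a : X.carrier) := fun u hu =>
    hW u (OpenSubgroup.mem_inf.mp hu).1
  have hZ' : ∀ u ∈ Z.sg, u • ((a' : G) : X.carrier) = (a' : X.carrier) := fun u hu =>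
    hW' u (OpenSubgroup.mem_inf.mp hu).2
  have hcomp : (homMk ((a : G) : X.carrier) hZ : Z ⟶ X) ≫ f = (homMk ((a' : G) : X.carrier) hZ' : Z ⟶ X) ≫ f :=
    hom_ext (by rw [pt_comp, pt_comp, pt_homMk, pt_homMk]; exact h)
  have heq := congrArg pt ((cancel_mono f).mp hcomp)
  rwa [pt_homMk, pt_homMk] at heq

end TopologicalGroup

/-! ### Bijective morphisms are isomorphisms; FSM-type -/

/-- A bijective morphism of `CosetCat G` is an isomorphism (the inverse map is again equivariant).
[cite: MochizukiFrdII2008, Ex 1.3 (i) p.11] -/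
theorem isIso_of_bijective {X Y : CosetCat G} (f : X ⟶ Y) (hf : Function.Bijective (Hom.toFun f)) : IsIso f := by
  let e : X.carrier ≃ Y.carrier := Equiv.ofBijective _ hf
  have he : ∀ x, e x = Hom.toFun f x := fun _ => rfl
  let g : Y ⟶ X :=
    { toFun := e.symm
      map_smul := fun a y => e.injective (by
        rw [he, he, Hom.map_smul, ← he, ← he, e.apply_symm_apply, e.apply_symm_apply]) }
  refine ⟨⟨g, hom_ext_toFun fun x => ?_, hom_ext_toFun fun y => ?_⟩⟩
  · change e.symm (Hom.toFun f x) = x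
    rw [← he, e.symm_apply_apply]
  · change Hom.toFun f (e.symm y) = y
    rw [← he, e.apply_symm_apply]

/-- **"Every monomorphism of `𝓑(G)⁰` is an isomorphism"** (FrdII Ex. 1.3 (i), p. 11), for the small model
`CosetCat G` of a topological group `G`. [cite: MochizukiFrdII2008, Ex 1.3 (i) p.11] -/
theorem isIso_of_mono [IsTopologicalGroup G] {X Y : CosetCat G} (f : X ⟶ Y) [Mono f] : IsIso f :=
  isIso_of_bijective f ⟨toFun_injective_of_mono f, toFun_surjective f⟩

/-- **`CosetCat G` is of FSM-type** ([FrdI] §0: every FSM-morphism — in particular a monomorphism — is an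
isomorphism); FrdII Ex. 1.1 (i) p. 7 for `D₀`, Ex. 1.3 (i) p. 11 for `𝓑(Π)⁰`. [cite: MochizukiFrdII2008, Ex 1.3 (i) p.11] -/
theorem isOfFSMType [IsTopologicalGroup G] : IsOfFSMType (CosetCat G) :=
  ⟨fun f hf => by
    haveI := hf.2
    exact isIso_of_mono f⟩

/-- **`CosetCat G` is of FSMFF-type** ("hence, in particular, of FSMFF-type", FrdII pp. 7, 11; [FrdI] §0).
[cite: MochizukiFrdII2008, Ex 1.3 (i) p.11] -/
theorem isOfFSMFFType [IsTopologicalGroup G] : IsOfFSMFFType (CosetCat G) :=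
  isOfFSMType.isOfFSMFFType

end CosetCat

end Literature.AnabelianGeometry.SemiGraphs
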